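import Literature.MathematicalPhysics.QuantumFieldTheory.Balaban1983to89.B9Eq326LocalPartBlockDecayClosed
import Literature.MathematicalPhysics.QuantumFieldTheory.Balaban1983to89.B9Eq347LocalFromBlockDecay
import Literature.MathematicalPhysics.QuantumFieldTheory.Balaban1983to89.B9Eq342GradientRowBlockCurrency

/-!
# `Balaban1983to89.B9Eq326LocalPartPointRow` — T. Bałaban, *Propagators for lattice gauge theories in a background field*, Commun. Math. Phys. **99**
# (1985) 389–434 [Balaban1985BackgroundPropagators] Thm 3.1 (3.42) p. 397 FIRST ENTRY *«|(G λ)(x)| ≤ B₀e^{−δ₀d(y,y′)}|λ| for x ∈ Δ(y), supp λ ⊂ Δ(y′)»*,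
# (3.26) p. 395, (3.49) p. 399, Thm 3.11 p. 416, with [Balaban1984PropagatorsI] p. 36 (the `cosh` weight): **THE POINTWISE BLOCK-DECAY ROW OF
# `u = A₀⁻¹f` FOR BLOCK-SUPPORTED DATA, AND ITS READING IN STOREY J's `cosh` CURRENCY** — for the local part `A₀ = Δ(U) + D_UD*_U + Q(U)†(a•Q(U))` at
# print's one-step vector averaging and `f` supported over the bonds of ONE block `B(v)` with `sup‖f(b)‖ ≤ F`:
# `‖(A₀⁻¹f)(b)‖ ≤ (4∕γ)e^{r}·√(d·L^d)·e^{−r·d_m(B(b₋), v)}·F` (one-step price `√(d·L^d)` of reading an `L²` block bound pointwise), and for every centre `y`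
# and every `cosh` rate `θ` with `r ≤ θL`: `‖(A₀⁻¹f)(b)‖ ≤ (2e^{θ(L−1)}·(4∕γ)e^{r}√(dL^d)·F·e^{−r·d_m(B(y), v)})·W_y(b₋)` — the `hval` ∕ `N_u` row that
# ne9-leaf-05's storey-J assembly at `A₀` (`B9Eq342GradientRowAssembly` §5 ∕ `B9Eq326LocalPartDivergenceRow`, map `STOREY-J-A0-MAP-g85.md` §3 (a)) and
# the currency junction (K52) `B9Eq342GradientRowBlockCurrency` (C) consume («the block decay of `u` (the OWNER's (D0)∕(I0) read pointwise)», K52 HONEST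
# SCOPE; t4-ne9-idea-1 L-g150-2: «currency junction = OWNER's call»)

statement-level skeleton of published theorems with citation tags; proofs where landed; nothing here is a claim about the Yang–Mills mass gap

CITATION HEADER (lean-in-tree rule).  Audit cell `pub-balaban`, sub-cell `t4`, BINDER row NE9; filed by the NE9 BINDER-row OWNER lineage
`b2b-balaban-t4-ne9-p1` (gen 94).  Imports gen 94's `B9Eq326LocalPartBlockDecayClosed` (`norm_block_localInv_le_closed`: the `L²` block decay of `A₀⁻¹`,
closed form), ne9-leaf-03's (K) `B9Eq347LocalFromBlockDecay` (`local_of_block_decay`: the abstract change of currency `L²` block bound → pointwise letter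
(L), with `norm_le_sqrt_mass_mul`; `B9Eq349BlockDecayFromKernel.card_sites_block_le` through it) and ne9-leaf-05's (K52) `B9Eq342GradientRowBlockCurrency`
(`weighted_row_of_block_decay`: a block-decay bound from the source block is a weighted row relative to every centre; through it the OWNER's
`B9Eq342CoshWeightSite`).  Sources READ first-hand (`paper:balaban1985-cmp99-background-propagators`, journal page = PDF page + 388): p. 397 Thm 3.1 (3.42)
and the sentence on `x ∈ Δ(y)`, `supp λ ⊂ Δ(y′)`; p. 395 (3.26); p. 399 (3.49); p. 416 Thm 3.11; [Balaban1984PropagatorsI] p. 36.  Print's decay proof is the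
random walk of Sect. C; the cell's road is Combes–Thomas (road B8″) + block read-out; the `√(d·L^d)` is the one-step price of record ((K) HONEST SCOPE) —
height-free rows are storey J's ∕ the bootstrap's business (`B9Eq342SupNormDecayFromBlockDecay`), not this file's.

WHAT IS PROVED (sorry-free; proof lane — no `def`; [folklore] counting + composition BY NAME).
* §1 `sum_bondBlock_mass_le` — the bond-block mass: `Σ_b [B(b₋) = v]·c₀ ≤ c₀·(d·L^d)`; **`pointRow_of_bondBlockDecay`** — for ANY `T : L²(fine bonds) →L
  L²(fine bonds)` with the cell's block-decay shape `‖P_{y₁}∘T∘P_{y₀}‖ ≤ C·e^{−κ·d_m(y₀,y₁)}` and `f` supported over `B(v)` with `‖f(b)‖ ≤ F`: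
  `‖(Tf)(b)‖ ≤ C·√(d·L^d)·e^{−κ·d_m(B(b₋), v)}·F` ((K) `local_of_block_decay` on the bond carrier, `μ = c₀dL^d`, `ω = c₀`); `sum_coarsePoint_mass_le` +
  **`pointRow_of_coarsePointBlockDecay`** — the same for `T : L²(coarse bonds; c₁) →L L²(fine bonds; c₀)` with a coarse-bond POINT source family
  (ne9-leaf-03's `H₁` ∕ `(QG₁Q†)⁻¹` END shape): `‖(Tg)(b)‖ ≤ C·(√(d·c₁)∕√c₀)·e^{−κ·d_m(B(b₋), v)}·G`.
* §2 **`norm_localInv_apply_le_blockDecay`** — the instance at `A₀⁻¹` in the CLOSED windows of `B9Eq326LocalPartBlockDecayClosed` (`γ` displayed):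
  `‖(A₀⁻¹f)(b)‖ ≤ (4∕γ)e^{r}·√(d·L^d)·e^{−r·d_m(B(b₋), v)}·F`.
* §3 **`norm_localInv_apply_le_weighted`** — the same row in the `cosh` currency of storey J: for `0 ≤ θ`, `r ≤ θL` and every centre `y`,
  `‖(A₀⁻¹f)(b)‖ ≤ (2e^{θ(L−1)}·((4∕γ)e^{r}√(dL^d)·F)·e^{−r·d_m(B(y), v)})·W_y(b₋)`, `W_y(x) = Π_μ cosh(θ·|y_μ − x_μ|∘)` ((K52) `weighted_row_of_block_decay`).
HONEST SCOPE.  Change of currency + composition; `γ` (Thm 3.11) and `hpos₀` displayed with the MODEL letters and the CLOSED windows of the parent; ONE step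
(`ηL = 1`); crude constants; nothing of [B9] Thm 3.1∕3.3∕3.11 asserted, valued or discharged; «NE9 ⇐ the named binders»; NE9 NOT PRINTED ∕ NOT PROVED; row
WALLED ON A MODEL (O-NE9-1; #5 UNRULED); spine PROVED 0∕9; rung (B)+1 on a finite T⁴ — NOT infinite volume, NOT mass gap, NOT BetaPertH, NOT Clay.  HONEST
DEPENDENCY: continuum YM on T⁴ ⇐ BetaPertH ∧ nine spine estimates (0/9 proved); BetaPertH ⇐ (D1) ∧ (D4) ∧ CAP+tail.  NEW file; nothing modified.  Net new
unproved facts: 0.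
-/

noncomputable section

set_option autoImplicit false

open scoped InnerProductSpace ComplexConjugate BigOperators
open NormedSpace

namespace Literature.MathematicalPhysics.QuantumFieldTheory.Balaban1983to89.B9Eq326LocalPartPointRow

open B4Sect5Torus (TSite tdist tdist_symm)
open B4TorusKernel.MultiPeriod (circAbs)
open B9SectCLatticeCarrier (Bond DirPair bpos btgt)
open B9Eq311L2Pairing (WL2)
open B9Eq319QprimeTorus (fineP blockCoord)
open B7Prop1Explicit (U1 Wcx boxVec)
open B11Eq103H1Complex (SiteL2K BondL2K greenK covDerivL2K covDivL2K)
open B9Eq310DeltaPrime (reHol imHol)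
open B9Eq310HessianOperator (adTransportW PlaqL2K curvOp hessOp)
open B9Eq315QTorus (perCfg cornerSite QtorusW)
open B9Eq326LocalPartBlockDecayClosed (norm_block_localInv_le_closed)
open B9Eq347LocalFromBlockDecay (local_of_block_decay)
open B9Eq349BlockDecayFromKernel (card_sites_block_le)
open B9Eq342GradientRowBlockCurrency (weighted_row_of_block_decay)

/-! ## §1 From a bond block-decay bound to the pointwise row (one step) -/

section Generic

variable {d : ℕ} (L : ℕ) [NeZero L] (m : Fin d → ℕ) {c₀ : ℝ} [Fact (0 < c₀)]
  {W : Type*} [NormedAddCommGroup W] [InnerProductSpace ℂ W]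

/-- **The bond-block mass**: the fine bonds based in one block weigh `Σ_b [B(b₋) = v]·c₀ ≤ c₀·(d·L^d)` (`d` directions × `L^d` sites,
`B9Eq349BlockDecayFromKernel.card_sites_block_le`). [folklore] [cite: Balaban1985Averaging, (2) p.17; Balaban1985BackgroundPropagators, (3.11) p.392] -/
theorem sum_bondBlock_mass_le (v : TSite d m) :
    ∑ b : Bond d (fineP L m), (if blockCoord L m (bpos b) = v then c₀ else 0) ≤ c₀ * (d * (L : ℝ) ^ d) := by
  have hc₀ : 0 < c₀ := Fact.out
  have hsite : ∑ x : TSite d (fineP L m), (if blockCoord L m x = v then c₀ else 0) ≤ c₀ * (L : ℝ) ^ d := by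
    rw [← Finset.sum_filter, Finset.sum_const, nsmul_eq_mul, mul_comm]
    exact mul_le_mul_of_nonneg_left (by exact_mod_cast card_sites_block_le (L := L) (m := m) v) hc₀.le
  calc ∑ b : Bond d (fineP L m), (if blockCoord L m (bpos b) = v then c₀ else 0)
      = ∑ x : TSite d (fineP L m), ∑ _k : Fin d, (if blockCoord L m x = v then c₀ else 0) := by rw [Fintype.sum_prod_type]
    _ = ∑ x : TSite d (fineP L m), (d : ℝ) * (if blockCoord L m x = v then c₀ else 0) := by
        refine Finset.sum_congr rfl fun x _ => ?_
        rw [Finset.sum_const, Finset.card_univ, Fintype.card_fin, nsmul_eq_mul]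
    _ = (d : ℝ) * ∑ x : TSite d (fineP L m), (if blockCoord L m x = v then c₀ else 0) := by rw [Finset.mul_sum]
    _ ≤ (d : ℝ) * (c₀ * (L : ℝ) ^ d) := mul_le_mul_of_nonneg_left hsite (Nat.cast_nonneg _)
    _ = c₀ * (d * (L : ℝ) ^ d) := by ring

/-- **FROM A BOND BLOCK-DECAY BOUND TO THE POINTWISE ROW (ONE STEP)**: `T : L²(fine bonds) →L L²(fine bonds)` with `‖P_{y₁}∘T∘P_{y₀}‖ ≤ C·e^{−κ·d_m(y₀,y₁)}`
(the cell's shape: source block first) and `f` supported over the bonds of `B(v)` with `‖f(b)‖ ≤ F` ⟹ `‖(Tf)(b)‖ ≤ C·√(d·L^d)·e^{−κ·d_m(B(b₋), v)}·F` —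
(K) `B9Eq347LocalFromBlockDecay.local_of_block_decay` on the bond carrier (`μ = c₀·d·L^d`, `ω = c₀`). [folklore]
[cite: Balaban1985BackgroundPropagators, Thm 3.1 (3.42) p.397, (3.49) p.399] -/
theorem pointRow_of_bondBlockDecay (hm : ∀ i, 1 ≤ m i) (T : BondL2K ℂ d (fineP L m) c₀ W →L[ℂ] BondL2K ℂ d (fineP L m) c₀ W)
    {PB : TSite d m → BondL2K ℂ d (fineP L m) c₀ W →L[ℂ] BondL2K ℂ d (fineP L m) c₀ W}
    (hPB : ∀ (y : TSite d m) (f : BondL2K ℂ d (fineP L m) c₀ W) (b : Bond d (fineP L m)),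
      WL2.equiv ℂ (fun _ : Bond d (fineP L m) => c₀) W (PB y f) b =
        if blockCoord L m (bpos b) = y then WL2.equiv ℂ (fun _ : Bond d (fineP L m) => c₀) W f b else 0)
    {C κ : ℝ} (hC : 0 ≤ C) (hdec : ∀ y₀ y₁, ‖PB y₁ ∘L T ∘L PB y₀‖ ≤ C * Real.exp (-(κ * tdist m y₀ y₁)))
    (v : TSite d m) (f : BondL2K ℂ d (fineP L m) c₀ W) (F : ℝ)
    (hfv : ∀ b, blockCoord L m (bpos b) ≠ v → WL2.equiv ℂ (fun _ : Bond d (fineP L m) => c₀) W f b = 0)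
    (hfF : ∀ b, ‖WL2.equiv ℂ (fun _ : Bond d (fineP L m) => c₀) W f b‖ ≤ F) (b : Bond d (fineP L m)) :
    ‖WL2.equiv ℂ (fun _ : Bond d (fineP L m) => c₀) W (T f) b‖ ≤
      C * Real.sqrt (d * (L : ℝ) ^ d) * Real.exp (-(κ * tdist m (blockCoord L m (bpos b)) v)) * F := by
  have hc₀ : 0 < c₀ := Fact.out
  haveI : Nonempty (Bond d (fineP L m)) := ⟨b⟩
  have h := local_of_block_decay (π := fun b : Bond d (fineP L m) => blockCoord L m (bpos b))
    (π' := fun b : Bond d (fineP L m) => blockCoord L m (bpos b)) hPB hPB T (tdist m) hC hc₀ (fun _ => le_rfl)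
    (sum_bondBlock_mass_le L m) (fun u u' => by rw [tdist_symm hm]; exact hdec u' u) v f F hfv hfF b
  calc _ ≤ C * Real.sqrt (c₀ * (d * (L : ℝ) ^ d)) / Real.sqrt c₀ * Real.exp (-(κ * tdist m (blockCoord L m (bpos b)) v)) * F := h
    _ = C * Real.sqrt (d * (L : ℝ) ^ d) * Real.exp (-(κ * tdist m (blockCoord L m (bpos b)) v)) * F := by
        rw [Real.sqrt_mul hc₀.le, mul_div_assoc, mul_div_cancel_left₀ _ (Real.sqrt_pos.2 hc₀).ne']

/-- **The coarse bond-point mass**: the `d` coarse bonds issuing from one coarse site weigh `Σ_c [c₋ = v]·c₁ ≤ c₁·d`. [folklore]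
[cite: Balaban1985Averaging, (2) p.17; Balaban1985BackgroundPropagators, (3.11) p.392] -/
theorem sum_coarsePoint_mass_le {c₁ : ℝ} [Fact (0 < c₁)] (v : TSite d m) :
    ∑ c : Bond d m, (if bpos c = v then c₁ else 0) ≤ c₁ * d := by
  have hc₁ : 0 < c₁ := Fact.out
  have hsite : ∑ x : TSite d m, (if x = v then c₁ else 0) = c₁ := by rw [Finset.sum_ite_eq' Finset.univ v]; simp
  calc ∑ c : Bond d m, (if bpos c = v then c₁ else 0)
      = ∑ x : TSite d m, ∑ _k : Fin d, (if x = v then c₁ else 0) := by rw [Fintype.sum_prod_type]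
    _ = ∑ x : TSite d m, (d : ℝ) * (if x = v then c₁ else 0) := by
        refine Finset.sum_congr rfl fun x _ => ?_
        rw [Finset.sum_const, Finset.card_univ, Fintype.card_fin, nsmul_eq_mul]
    _ = (d : ℝ) * c₁ := by rw [← Finset.mul_sum, hsite]
    _ ≤ c₁ * d := by rw [mul_comm]

omit [NeZero L] in
/-- **FROM A COARSE-POINT-TO-FINE-BLOCK DECAY BOUND TO THE POINTWISE ROW (ONE STEP)** — the source shape of ne9-leaf-03's `H₁` ∕ `(QG₁Q†)⁻¹` ENDs
(`B9Eq3126H1BlockDecay.norm_block_H1ofU_le`: `‖P_{y₁} ∘ T ∘ r_{y₀}‖ ≤ C·e^{−κ·d_m(y₀,y₁)}` with the coarse-bond POINT family `r_y` = the `d` bonds issuing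
from `y`): `T : L²(coarse bonds; c₁) →L L²(fine bonds; c₀)` and `g` supported on the bonds issuing from `v` with `‖g(c)‖ ≤ G` ⟹
`‖(Tg)(b)‖ ≤ C·(√(d·c₁)∕√c₀)·e^{−κ·d_m(B(b₋), v)}·G` (on print's diagonal `c₁ = c₀L^d` the factor is `√(d·L^d)`). [folklore]
[cite: Balaban1985BackgroundPropagators, (3.49) p.399, Thm 3.1 (3.42) p.397] -/
theorem pointRow_of_coarsePointBlockDecay {c₁ : ℝ} [Fact (0 < c₁)] (hm : ∀ i, 1 ≤ m i)
    (T : BondL2K ℂ d m c₁ W →L[ℂ] BondL2K ℂ d (fineP L m) c₀ W)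
    {PB : TSite d m → BondL2K ℂ d (fineP L m) c₀ W →L[ℂ] BondL2K ℂ d (fineP L m) c₀ W}
    (hPB : ∀ (y : TSite d m) (f : BondL2K ℂ d (fineP L m) c₀ W) (b : Bond d (fineP L m)),
      WL2.equiv ℂ (fun _ : Bond d (fineP L m) => c₀) W (PB y f) b =
        if blockCoord L m (bpos b) = y then WL2.equiv ℂ (fun _ : Bond d (fineP L m) => c₀) W f b else 0)
    {rF : TSite d m → BondL2K ℂ d m c₁ W →L[ℂ] BondL2K ℂ d m c₁ W}
    (hrF : ∀ (y : TSite d m) (g : BondL2K ℂ d m c₁ W) (c : Bond d m),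
      WL2.equiv ℂ (fun _ : Bond d m => c₁) W (rF y g) c = if bpos c = y then WL2.equiv ℂ (fun _ : Bond d m => c₁) W g c else 0)
    {C κ : ℝ} (hC : 0 ≤ C) (hdec : ∀ y₀ y₁, ‖PB y₁ ∘L T ∘L rF y₀‖ ≤ C * Real.exp (-(κ * tdist m y₀ y₁)))
    (v : TSite d m) (g : BondL2K ℂ d m c₁ W) (G : ℝ)
    (hgv : ∀ c, bpos c ≠ v → WL2.equiv ℂ (fun _ : Bond d m => c₁) W g c = 0)
    (hgG : ∀ c, ‖WL2.equiv ℂ (fun _ : Bond d m => c₁) W g c‖ ≤ G) [Nonempty (Bond d m)] (b : Bond d (fineP L m)) :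
    ‖WL2.equiv ℂ (fun _ : Bond d (fineP L m) => c₀) W (T g) b‖ ≤
      C * (Real.sqrt (d * c₁) / Real.sqrt c₀) * Real.exp (-(κ * tdist m (blockCoord L m (bpos b)) v)) * G := by
  have hc₀ : 0 < c₀ := Fact.out
  have h := local_of_block_decay (π := fun c : Bond d m => bpos c) (π' := fun b : Bond d (fineP L m) => blockCoord L m (bpos b)) hrF hPB T (tdist m)
    hC hc₀ (fun _ => le_rfl) (fun u => by simpa only [mul_comm] using sum_coarsePoint_mass_le (m := m) (c₁ := c₁) u)
    (fun u u' => by rw [tdist_symm hm]; exact hdec u' u) v g G hgv hgG b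
  calc _ ≤ C * Real.sqrt (c₁ * d) / Real.sqrt c₀ * Real.exp (-(κ * tdist m (blockCoord L m (bpos b)) v)) * G := h
    _ = C * (Real.sqrt (d * c₁) / Real.sqrt c₀) * Real.exp (-(κ * tdist m (blockCoord L m (bpos b)) v)) * G := by rw [mul_comm c₁, mul_div_assoc]

end Generic

/-! ## §2 The instance at `A₀⁻¹` (closed windows) and §3 its `cosh`-currency reading -/

section Instance

variable {d : ℕ} (L : ℕ) [NeZero L] (m : Fin d → ℕ) [∀ i, NeZero (fineP L m i)]
  {𝔸 : Type*} [NormedRing 𝔸] [StarRing 𝔸] [NormedAlgebra ℂ 𝔸] [StarModule ℂ 𝔸] [NormOneClass 𝔸] [CompleteSpace 𝔸] (hL : 1 ≤ L)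
  {W : Type*} [NormedAddCommGroup W] [InnerProductSpace ℂ W] [FiniteDimensional ℂ W] (φ : W ≃ₗ[ℂ] 𝔸) {Mφ Mφ' : ℝ}
  (hφ : ∀ w, ‖φ w‖ ≤ Mφ * ‖w‖) (hφ' : ∀ X, ‖φ.symm X‖ ≤ Mφ' * ‖X‖) (hMφ : 0 ≤ Mφ) (hMφ' : 0 ≤ Mφ') (hstar : ∀ X : 𝔸, ‖star X‖ ≤ ‖X‖)
  {c₀ c₁ : ℝ} [Fact (0 < c₀)] [Fact (0 < c₁)] {η : ℝ} (hη : 0 < η) (hηL : η * L = 1)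
  (U : Bond d (fineP L m) → 𝔸ˣ) (hU : ∀ b, U b ∈ U1 𝔸)
  (hRS : ∀ (b : Bond d (fineP L m)) (v u : W), ⟪adTransportW φ U b v, u⟫_ℂ = ⟪v, adTransportW φ (fun b => (U b)⁻¹) b u⟫_ℂ)
  {α : ℝ} (hα1 : α ≤ 1 / 64)
  (hU1 : ∀ (x : B7Prop1Explicit.Site d) (k : Fin d), perCfg (fineP L m) U x k ∈ U1 𝔸)
  (hreg : ∀ (y : TSite d m) (k : Fin d) (ρ : Fin d → Fin L),
    ‖((Wcx L (perCfg (fineP L m) U) (cornerSite L y) k (boxVec L ρ) : 𝔸ˣ) : 𝔸) - 1‖ ≤ α)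
  {α' : ℝ} (hα1' : α' ≤ 1 / 64)
  (hU1' : ∀ (x : B7Prop1Explicit.Site d) (k : Fin d), perCfg (fineP L m) (fun _ : Bond d (fineP L m) => (1 : 𝔸ˣ)) x k ∈ U1 𝔸)
  (hreg' : ∀ (y : TSite d m) (k : Fin d) (ρ : Fin d → Fin L),
    ‖((Wcx L (perCfg (fineP L m) (fun _ : Bond d (fineP L m) => (1 : 𝔸ˣ))) (cornerSite L y) k (boxVec L ρ) : 𝔸ˣ) : 𝔸) - 1‖ ≤ α')
  {εU : ℝ} (hεU : 0 ≤ εU) (hUε : ∀ b : Bond d (fineP L m), ‖(U b : 𝔸) - 1‖ ≤ εU)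
  (τ : 𝔸 →ₗ[ℂ] ℂ) {Mτ : ℝ} (hτ : ∀ X Y : 𝔸, ‖τ (X * Y)‖ ≤ Mτ * ‖X‖ * ‖Y‖) (hMτ : 0 ≤ Mτ)
  {δ : ℝ} (hδ : 0 ≤ δ)
  (hRe : ∀ p : B9SectCLatticeCarrier.Plaq d (fineP L m), ‖reHol U p - 1‖ ≤ δ)
  (hIm : ∀ p : B9SectCLatticeCarrier.Plaq d (fineP L m), ‖imHol U p‖ ≤ δ)
  (a : ℝ) (ha : 0 ≤ a) (hm : ∀ i, 1 ≤ m i)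
  (A₀ : BondL2K ℂ d (fineP L m) c₀ W →ₗ[ℂ] BondL2K ℂ d (fineP L m) c₀ W)
  (hA₀ : A₀ = hessOp φ η U τ + covDerivL2K ℂ c₀ ((η : ℂ))⁻¹ (adTransportW φ U) ∘ₗ covDivL2K ℂ c₀ ((η : ℂ))⁻¹ (adTransportW φ fun b => (U b)⁻¹) +
    LinearMap.adjoint (QtorusW L m hL φ U hα1 hU1 hreg (c₀ := c₀) (c₁ := c₁)) ∘ₗ
      ((a : ℂ) • QtorusW L m hL φ U hα1 hU1 hreg (c₀ := c₀) (c₁ := c₁)))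
  (hpos₀ : ∀ x : BondL2K ℂ d (fineP L m) c₀ W, x ≠ 0 → 0 < RCLike.re ⟪x, A₀ x⟫_ℂ)
  {γ β r : ℝ} (hγ : 0 < γ) (hβ : 0 ≤ β) (hr : 0 ≤ r)
  (hcoer : ∀ f : BondL2K ℂ d (fineP L m) c₀ W, γ * ‖f‖ ^ 2 ≤ RCLike.re ⟪f, A₀ f⟫_ℂ)
  (hwin : r * η ≤ 1) (hr4 : 4 * r ≤ 1)
  (hβCC : 4 * r * (Mφ * Mφ') * (d * Real.sqrt d) ≤ β) (hβC : 4 * r * (Mφ * Mφ') * d ≤ β) (hβD : 2 * r * (Mφ * Mφ') * Real.sqrt d ≤ β)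
  (hβQ : 8 * r * (Mφ' * Mφ * Real.sqrt (2 * (c₁ / c₀) * (2 * d * (102 * (d + 1) ^ 2 * L * εU) ^ 2 + ((L : ℝ) ^ d)⁻¹))) ≤ β)
  (small : (768 * Fintype.card (DirPair d) * Mτ * Mφ ^ 2 * (‖((η : ℂ)) ^ d‖ / c₀) * ‖((η : ℂ))⁻¹‖ ^ 2 * δ) / 2 + 3 * (2 + a) * β ^ 2 +
    8 * (r * η) * (768 * Fintype.card (DirPair d) * Mτ * Mφ ^ 2 * (‖((η : ℂ)) ^ d‖ / c₀) * ‖((η : ℂ))⁻¹‖ ^ 2 * δ) ≤ γ / 4)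
  (PB : TSite d m → BondL2K ℂ d (fineP L m) c₀ W →L[ℂ] BondL2K ℂ d (fineP L m) c₀ W)
  (hPB : ∀ (y : TSite d m) (f : BondL2K ℂ d (fineP L m) c₀ W) (b : Bond d (fineP L m)),
    WL2.equiv ℂ (fun _ : Bond d (fineP L m) => c₀) W (PB y f) b =
      if blockCoord L m (bpos b) = y then WL2.equiv ℂ (fun _ : Bond d (fineP L m) => c₀) W f b else 0)
  (v : TSite d m) (f : BondL2K ℂ d (fineP L m) c₀ W) {F : ℝ} (hF : 0 ≤ F)
  (hfv : ∀ b, blockCoord L m (bpos b) ≠ v → WL2.equiv ℂ (fun _ : Bond d (fineP L m) => c₀) W f b = 0)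
  (hfF : ∀ b, ‖WL2.equiv ℂ (fun _ : Bond d (fineP L m) => c₀) W f b‖ ≤ F)

include hφ hφ' hMφ hMφ' hstar hη hηL hU hRS hα1' hU1' hreg' hεU hUε hτ hMτ hδ hRe hIm ha hm hA₀ hγ hβ hr hcoer hwin hr4 hβCC hβC hβD hβQ small hPB hfv
  hfF in
/-- **THE POINTWISE BLOCK-DECAY ROW OF `u = A₀⁻¹f` FOR BLOCK-SUPPORTED DATA** ([B9] Thm 3.1 (3.42), first entry, SHAPE — for the local part `A₀` at the
cell's rate): `f` supported over the bonds of `B(v)` with `‖f(b)‖ ≤ F` ⟹ `‖(A₀⁻¹f)(b)‖ ≤ (4∕γ)e^{r}·√(d·L^d)·e^{−r·d_m(B(b₋), v)}·F` in the CLOSED windows of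
`B9Eq326LocalPartBlockDecayClosed.norm_block_localInv_le_closed` (`γ` displayed). [cite: Balaban1985BackgroundPropagators, Thm 3.1 (3.42) p.397, (3.26) p.395,
Thm 3.11 p.416, (3.49) p.399] -/
theorem norm_localInv_apply_le_blockDecay (b : Bond d (fineP L m)) :
    ‖WL2.equiv ℂ (fun _ : Bond d (fineP L m) => c₀) W (greenK A₀ hpos₀ f) b‖ ≤
      4 / γ * Real.exp r * Real.sqrt (d * (L : ℝ) ^ d) * Real.exp (-(r * tdist m (blockCoord L m (bpos b)) v)) * F := by
  have h := pointRow_of_bondBlockDecay L m hm (LinearMap.toContinuousLinearMap (greenK A₀ hpos₀)) hPB (C := 4 / γ * Real.exp r) (κ := r)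
    (by positivity)
    (fun y₀ y₁ => norm_block_localInv_le_closed L m hL φ hφ hφ' hMφ hMφ' hstar hη hηL U hU hRS hα1 hU1 hreg hα1' hU1' hreg' hεU hUε τ hτ hMτ hδ
      hRe hIm a ha hm A₀ hA₀ hpos₀ hγ hβ hr hcoer hwin hr4 hβCC hβC hβD hβQ small PB hPB y₀ y₁) v f F hfv hfF b
  simpa only [LinearMap.coe_toContinuousLinearMap'] using h

include hφ hφ' hMφ hMφ' hstar hη hηL hU hRS hα1' hU1' hreg' hεU hUε hτ hMτ hδ hRe hIm ha hm hA₀ hγ hβ hr hcoer hwin hr4 hβCC hβC hβD hβQ small hPB hfv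
  hfF hF in
/-- **THE SAME ROW IN STOREY J's `cosh` CURRENCY** (the `hval` ∕ `N_u` row of ne9-leaf-05's `B9Eq342GradientRowAssembly` §5 ∕ `B9Eq326LocalPartDivergenceRow`
at every centre `y`): for a `cosh` rate `θ ≥ 0` with `r ≤ θL`,
`‖(A₀⁻¹f)(b)‖ ≤ (2e^{θ(L−1)}·((4∕γ)e^{r}√(d·L^d)·F)·e^{−r·d_m(B(y), v)})·W_y(b₋)`, `W_y(x) = Π_μ cosh(θ·|y_μ − x_μ|∘)` — (K52)
`B9Eq342GradientRowBlockCurrency.weighted_row_of_block_decay` BY NAME on §2. [cite: Balaban1985BackgroundPropagators, Thm 3.1 (3.42) p.397, (3.49) p.399;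
Balaban1984PropagatorsI, p.36] -/
theorem norm_localInv_apply_le_weighted {θ : ℝ} (hθ : 0 ≤ θ) (hrθ : r ≤ θ * (L : ℝ)) (y : TSite d (fineP L m)) (b : Bond d (fineP L m)) :
    ‖WL2.equiv ℂ (fun _ : Bond d (fineP L m) => c₀) W (greenK A₀ hpos₀ f) b‖ ≤
      (2 * Real.exp (θ * ((L : ℝ) - 1)) * (4 / γ * Real.exp r * Real.sqrt (d * (L : ℝ) ^ d) * F) *
          Real.exp (-(r * tdist m (blockCoord L m y) v))) *
        (fun x : TSite d (fineP L m) =>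
          ∏ μ, Real.cosh (θ * (circAbs (fineP L m μ) (ZMod.val (((y μ : ℕ) : ZMod (fineP L m μ)) - ((x μ : ℕ) : ZMod (fineP L m μ)))) : ℝ))) (bpos b) := by
  refine weighted_row_of_block_decay L m hm hθ (fun b : Bond d (fineP L m) => bpos b)
    (fun b : Bond d (fineP L m) => WL2.equiv ℂ (fun _ : Bond d (fineP L m) => c₀) W (greenK A₀ hpos₀ f) b) v (by positivity) hr hrθ (fun b' => ?_) y b
  have h := norm_localInv_apply_le_blockDecay L m hL φ hφ hφ' hMφ hMφ' hstar hη hηL U hU hRS hα1 hU1 hreg hα1' hU1' hreg' hεU hUε τ hτ hMτ hδ hRe hIm a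
    ha hm A₀ hA₀ hpos₀ hγ hβ hr hcoer hwin hr4 hβCC hβC hβD hβQ small PB hPB v f hfv hfF b'
  calc _ ≤ _ := h
    _ = 4 / γ * Real.exp r * Real.sqrt (d * (L : ℝ) ^ d) * F * Real.exp (-(r * tdist m (blockCoord L m (bpos b')) v)) := by ring

end Instance

end Literature.MathematicalPhysics.QuantumFieldTheory.Balaban1983to89.B9Eq326LocalPartPointRow

end
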